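/-
Origin: expansion seat `planner-pub-hodgecm-mc-axioms-1-g14-0`, handover #W80 2026-08-20T15:53:55Z md5 21a8a6792b44 (PKG fb70e3f32419 → 21a8a6792b44; 245 l.; MECHANICAL (iib-R) rewrite v3.1 of the PKG file as it stands (81 token edits; rules R1x1+R2x9+RX[h₂']x64+R3x7)) (`HOME/mc/pub-hodgecm-mc-axioms-1-g14/revendor/kit-r55/stage55/HodgeCM/Model/LevelTransferNorm.lean`, md5 21a8a6792b44, 245 lines);
landed by the gen-22 packager (p-g22) in gate run 55 REPLACES the earlier landed copy of `HodgeCM/Model/LevelTransferNorm.lean` (seat copy carried the packager Origin header of an earlier run (stripped)).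
-/
/-
Origin: CONSTRUCTION seat `planner-pub-hodgecm-mc-axioms-1-g8-0` (unit pub-hodgecm-mc-axioms-1-g8, gen 8 of lineage
mc-axioms-1; MODEL-DAG node N-i1, ruling (L-lvl); desk booking model2-g6 (AAAA′) 2026-08-19T08:32:39Z: "N-i1 instance `D`
NORM HALF", KERNEL/GAGA route). NEW additive leaf `HodgeCM/Model/LevelTransferNorm.lean` over this lineage's
`Model/LevelTransferOf.lean` (gen 7, kit t36 row #9: the datum with its PUSH half constructed and the NORM half as two
binders) and the NEW vendored twin `Vendored/H21/AlgebraicGeometry/ShimuraVarieties/UnitaryBallLevelNorm.lean` of the tree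
file `Literature/AlgebraicGeometry/ShimuraVarieties/UnitaryBallLevelNorm.lean` (gen 8; with its cone: the twins of
`Motives/AlgPointsHolomorphicFamiliesAffine.lean` p185445, `SingularHomology/FiniteCoverNorm.lean` p185564, and the
`Motives.AlgPointsHolomorphicFamilies` cone). Nothing imports this file except `Model/HLiuOfSmallLevel.lean` (gen 8).
`Universe.LevelTransfer` (LevelDescent, gen 6) is NOT touched. Expected `#print axioms`: {propext, Classical.choice, Quot.sound}.
-/
import Summits.HodgeConjecture.HodgeCM.Model.LevelTransferOf
import Literature.AlgebraicGeometry.ShimuraVarieties.UnitaryBallLevelNorm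

/-!
# The norm half of the level transfer datum `D` (MODEL-DAG N-i1), CONSTRUCTED

For the Picard–CM model universe `U := picardCMUniverse hHD hI h₁ h₂ h₃`, two nested levels `Γ₁ ≤ Γ` of one hermitian
space `V` and the level covering `p := coverOf … hA Γ Γ₁ hle : X_{Γ₁} ⟶ X_Γ` (`Model/CoverInstance.lean`), the datum
`levelTransferOf … Γ Γ₁ hle norm hnorm : U.LevelTransfer p` of `Model/LevelTransferOf.lean` has its push half
(`deg := degOf`, the number of sheets of the finite covering `p(ℂ)`; `push := pushOf = deg •` the normalised transfer)
CONSTRUCTED and takes the norm half as two binders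

* `norm  : ∀ K Ψ, (X_{Γ₁} ⟶ A_{(K,Ψ)}) → (X_Γ ⟶ A_{(K,Ψ)})` and
* `hnorm : ∀ K Ψ F, pushOf … ∘ₗ F^* = (norm K Ψ F)^*` on `H¹(A_{(K,Ψ)}(ℂ); ℚ)`.

This file CONSTRUCTS both, as kernel terms over the same record binders as `coverOf` / `pushOf` and nothing else:

* `normOf … Γ Γ₁ hle K Ψ F : X_Γ ⟶ A_{(K,Ψ)}` — in the anisotropic regime (`IsAnisotropic L V.Hm`, where both surfaces are
  compact ball quotients with THE SAME hermitian matrix, `ballDatum_Hℂ_eq`, and `p(ℂ)` intertwines the two uniformisations,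
  `map_coverOf_unif`) the NORM MORPHISM `UnitaryBallUniformisationDatum.normHom` of the vendored tree file
  `ShimuraVarieties/UnitaryBallLevelNorm.lean`: on complex points it is the norm `x ↦ ∏_{p(y) = x} F(y)` in the commutative
  group `A(ℂ)` (`IsFiniteCover.normMap`), locally the product over the cosets `Γ₁ \ Γ` of the translates `F ∘ unif_{Γ₁} ∘ γ`
  (`normMap_unif_eventuallyEq`), holomorphic in Hodge models of the smooth projective `X_Γ` and `A` (`mdifferentiable_normAn`:
  Serre GAGA §2 n°5–6, Mumford §1 (1)) hence a morphism by the record `hA : Arapura2012_Cor_15_4_6` (the SAME record that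
  makes `coverOf` a morphism; no further record); off that regime (`p = eqToHom _`, one sheet) it is `eqToHom _ ≫ F`;
* `pushOf_comp_pull_eq_pull_normOf` (`hnormOf`) — `pushOf … ∘ₗ F^* = (normOf … F)^*` on `H¹`: in the anisotropic regime the
  tree theorem `UnitaryBallUniformisationDatum.sheets_smul_transferMap_pull_eq` (the transfer in `H¹(–; ℚ)` of a finite covering of
  a path-connected space is induced by the norm: `sheets • τ (F^* a) = (N_p F)^* a`, `SingularHomology/FiniteCoverNorm.lean`,
  Hatcher §3.G with Mumford §6), read through `degOf = sheets` and `U.pull f 1 = (H¹(f(ℂ)))`; off it `sheets = 1`, `τ = id`.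

Then `levelTransferNormOf` / `levelTransferFamilyNormOf := levelTransferFamilyOf … normOf hnormOf` is the datum `D` of
`hLiu_of_small` with BOTH halves constructed, and `Model/HLiuOfSmallLevel.lean` records that E's binder `hLiu` now costs the
level-smallness hypothesis `hsmall` ONLY.

References: N. Bergeron, J. Millson, C. Moeglin, *The Hodge conjecture and arithmetic quotients of complex balls*, Acta
Math. 216 (2016), Introduction §1.1, Part 2 §1.3; D. Mumford, *Abelian Varieties* (1970), §1 (1), §6; A. Hatcher,
*Algebraic Topology* (2002), §1.3 p. 61, §3.G Prop. 3G.1; J.-P. Serre, GAGA, Ann. Inst. Fourier 6 (1956), §2 n°5–6;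
D. Arapura, *Algebraic Geometry over the Complex Numbers* (2012), Cor. 15.4.6.
-/

noncomputable section

open scoped Matrix ComplexOrder
open NumberField CategoryTheory
open Literature.AlgebraicGeometry.Motives
open Literature.AlgebraicGeometry.ShimuraVarieties
open Literature.AlgebraicTopology.SingularHomology
open Literature.NumberTheory.Transcendental (Arapura2012_Cor_15_4_6)

namespace HodgeCM

namespace Model

open Literature.NumberTheory.Automorphic.PicardCM
open Literature.AlgebraicGeometry.HodgeTheory

/-! ### Off the anisotropic regime: a one-sheeted `eqToHom` covering -/

section General

/-- For an identity covering `p = eqToHom e : X ⟶ Y` of a connected non-empty `X(ℂ)`: the number of sheets is `1`, the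
normalised transfer is the identity, so `sheets • τ (F^* a) = (eqToHom e.symm ≫ F)^* a` on `H¹`. -/
theorem sheets_smul_transferMap_map_of_eq_eqToHom {X Y A : SchemeOver ℂ}
    [PreconnectedSpace (ComplexPoints X)] [Nonempty (ComplexPoints X)] (e : X = Y) {p : X ⟶ Y}
    (hp : p = eqToHom e) (c : IsFiniteCover (AlgPoints.mapContinuous (L := ℂ) p)) (F : X ⟶ A)
    (a : singularCohomology ℚ ℚ (ComplexPoints A) 1) :
    (c.sheets : ℚ) • c.transferMap (R := ℚ) 1
        (singularCohomology.map ℚ ℚ (AlgPoints.mapContinuous (L := ℂ) F) 1 a) =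
      singularCohomology.map ℚ ℚ (AlgPoints.mapContinuous (L := ℂ) (eqToHom e.symm ≫ F)) 1 a := by
  subst e
  subst hp
  obtain ⟨b⟩ := ‹Nonempty (ComplexPoints X)›
  have hid : AlgPoints.mapContinuous (L := ℂ) (eqToHom (rfl : X = X)) = ContinuousMap.id _ := by
    rw [eqToHom_refl, AlgPoints.mapContinuous_id]
  have hsh : c.sheets = 1 := by
    rw [c.sheets_eq_ncard_fibre b]
    have hfib : (AlgPoints.mapContinuous (L := ℂ) (eqToHom (rfl : X = X))) ⁻¹' {b} = {b} := by
      rw [hid]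
      rfl
    rw [hfib, Set.ncard_singleton]
  have hida : singularCohomology.map ℚ ℚ (AlgPoints.mapContinuous (L := ℂ) (eqToHom (rfl : X = X))) 1
      (singularCohomology.map ℚ ℚ (AlgPoints.mapContinuous (L := ℂ) F) 1 a) =
        singularCohomology.map ℚ ℚ (AlgPoints.mapContinuous (L := ℂ) F) 1 a := by
    rw [hid, singularCohomology.map_id]
    rfl
  have hτ := c.transferMap_map 1 (singularCohomology.map ℚ ℚ (AlgPoints.mapContinuous (L := ℂ) F) 1 a)
  rw [hida] at hτ
  rw [hsh, Nat.cast_one, one_smul, hτ, eqToHom_refl, Category.id_comp]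

end General

/-! ### On the end-state universe `picardCMUniverse`: `norm`, `push ∘ₗ F^* = norm^*` -/

section EndState

variable (hHD : exists_isReal_hodgeModel) (hI : hodgePQ_independent_of_hodgeModel)
  (h₁ : BallQuotientUniformised)  (h₃ : CMAbelianVarietyRealised)

/-- Off the anisotropic regime the two level surfaces are the same scheme (`ℙ²`). -/
theorem scheme_pms_eq_of_not_isAnisotropic {L : CMField} {ι₁ : L →+* ℂ} {V : HermSpace3 L ι₁}
    (Γ Γ₁ : Level V) (h : ¬ IsAnisotropic L V.Hm) :
    Var.scheme (ballQuotientUniformisedDatum_of h₁) h₃ (.pms (pmsCode L ι₁ V Γ₁)) =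
      Var.scheme (ballQuotientUniformisedDatum_of h₁) h₃ (.pms (pmsCode L ι₁ V Γ)) := by
  rw [scheme_pms_of_not_isAnisotropic _ h₃ _ (fun h' ↦ h ((isAnisotropic_pmsCode_iff L ι₁ V Γ₁).1 h')),
    scheme_pms_of_not_isAnisotropic _ h₃ _ (fun h' ↦ h ((isAnisotropic_pmsCode_iff L ι₁ V Γ).1 h'))]

/-- Off the anisotropic regime `coverOf` is the identity `eqToHom`. -/
theorem coverOf_eq_eqToHom_of_not_isAnisotropic (hA : Arapura2012_Cor_15_4_6) {L : CMField}
    {ι₁ : L →+* ℂ} {V : HermSpace3 L ι₁} (Γ Γ₁ : Level V) (hle : Γ₁.Γ ≤ Γ.Γ) (h : ¬ IsAnisotropic L V.Hm) :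
    coverOf hHD hI h₁ h₃ hA Γ Γ₁ hle =
      eqToHom (scheme_pms_eq_of_not_isAnisotropic h₁ h₃ Γ Γ₁ h) := by
  obtain ⟨e, he⟩ := levelCover_eq_eqToHom_of_not_isAnisotropic (ballQuotientUniformisedDatum_of h₁) h₃ hHD hA
    Γ Γ₁ hle h
  exact he

/-- **`norm`**: the norm of a morphism `F : X_{Γ₁} ⟶ A_{(K,Ψ)}` to a CM abelian variety of the universe along the level
covering `X_{Γ₁} ⟶ X_Γ` — a morphism `X_Γ ⟶ A_{(K,Ψ)}`. Anisotropic regime: the norm morphism of the ball-quotient level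
covering (`UnitaryBallUniformisationDatum.normHom`, on points `x ↦ ∏_{p(y)=x} F(y)`, locally `v ↦ ∏_{c ∈ Γ₁\Γ} F(unif_{Γ₁}(γ_c v))`),
a morphism by GAGA under `hA`; off it: `F` transported along the identity `eqToHom`. -/
def normOf (hA : Arapura2012_Cor_15_4_6) {L : CMField} {ι₁ : L →+* ℂ} {V : HermSpace3 L ι₁}
    (Γ Γ₁ : Level V) (hle : Γ₁.Γ ≤ Γ.Γ) (K : CMField) (Ψ : CMType K)
    (F : (picardCMUniverse hHD hI h₁ h₃).Mor ((picardCMUniverse hHD hI h₁ h₃).pms L ι₁ V Γ₁)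
      ((picardCMUniverse hHD hI h₁ h₃).cmAV K Ψ)) :
    (picardCMUniverse hHD hI h₁ h₃).Mor ((picardCMUniverse hHD hI h₁ h₃).pms L ι₁ V Γ)
      ((picardCMUniverse hHD hI h₁ h₃).cmAV K Ψ) :=
  open scoped Classical in
  if h : IsAnisotropic L V.Hm then
    UnitaryBallUniformisationDatum.normHom
      (ballDatum_Hℂ_eq (ballQuotientUniformisedDatum_of h₁) h₃ Γ Γ₁ ((isAnisotropic_pmsCode_iff L ι₁ V Γ₁).2 h)
        ((isAnisotropic_pmsCode_iff L ι₁ V Γ).2 h))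
      (AlgPoints.mapContinuous (L := ℂ) (coverOf hHD hI h₁ h₃ hA Γ Γ₁ hle))
      (fun _ hv ↦ map_coverOf_unif hHD hI h₁ h₃ hA hle h hv)
      (isFiniteCover_coverOf hHD hI h₁ h₃ hA Γ Γ₁ hle)
      (cmRealisation h₃ (cmCode K Ψ)).isSmoothProjective
      (BettiUniverse.realHodgeModel hHD
        (Var.isSmoothProjective (ballQuotientUniformisedDatum_of h₁) h₃ (.pms (pmsCode L ι₁ V Γ))))
      (BettiUniverse.realHodgeModel hHD (cmRealisation h₃ (cmCode K Ψ)).isSmoothProjective)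
      F hA
  else
    eqToHom (scheme_pms_eq_of_not_isAnisotropic h₁ h₃ Γ Γ₁ h).symm ≫ F

/-- Anisotropic regime, pointwise: `deg • τ (F^* a) = (normOf … F)^* a` on `H¹(A_{(K,Ψ)}(ℂ); ℚ)` — the tree theorem
`UnitaryBallUniformisationDatum.sheets_smul_transferMap_pull_eq` read through `degOf = sheets`, `U.pull f 1 = H¹(f(ℂ); ℚ)`. -/
theorem degOf_smul_transferMap_pull_apply_of_isAnisotropic (hA : Arapura2012_Cor_15_4_6) {L : CMField}
    {ι₁ : L →+* ℂ} {V : HermSpace3 L ι₁} (Γ Γ₁ : Level V) (hle : Γ₁.Γ ≤ Γ.Γ) (h : IsAnisotropic L V.Hm)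
    (K : CMField) (Ψ : CMType K)
    (F : (picardCMUniverse hHD hI h₁ h₃).Mor ((picardCMUniverse hHD hI h₁ h₃).pms L ι₁ V Γ₁)
      ((picardCMUniverse hHD hI h₁ h₃).cmAV K Ψ))
    (a : (picardCMUniverse hHD hI h₁ h₃).Coh ((picardCMUniverse hHD hI h₁ h₃).cmAV K Ψ) 1) :
    (degOf hHD hI h₁ h₃ hA Γ Γ₁ hle : ℚ) •
        ((isFiniteCover_coverOf hHD hI h₁ h₃ hA Γ Γ₁ hle).transferMap (R := ℚ) 1).hom
          ((picardCMUniverse hHD hI h₁ h₃).pull F 1 a) =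
      (picardCMUniverse hHD hI h₁ h₃).pull (normOf hHD hI h₁ h₃ hA Γ Γ₁ hle K Ψ F) 1 a := by
  rw [normOf, dif_pos h]
  exact UnitaryBallUniformisationDatum.sheets_smul_transferMap_pull_eq
    (ballDatum_Hℂ_eq (ballQuotientUniformisedDatum_of h₁) h₃ Γ Γ₁ ((isAnisotropic_pmsCode_iff L ι₁ V Γ₁).2 h)
      ((isAnisotropic_pmsCode_iff L ι₁ V Γ).2 h))
    (AlgPoints.mapContinuous (L := ℂ) (coverOf hHD hI h₁ h₃ hA Γ Γ₁ hle))
    (fun _ hv ↦ map_coverOf_unif hHD hI h₁ h₃ hA hle h hv)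
    (isFiniteCover_coverOf hHD hI h₁ h₃ hA Γ Γ₁ hle)
    (cmRealisation h₃ (cmCode K Ψ)).isSmoothProjective
    (BettiUniverse.realHodgeModel hHD
      (Var.isSmoothProjective (ballQuotientUniformisedDatum_of h₁) h₃ (.pms (pmsCode L ι₁ V Γ))))
    (BettiUniverse.realHodgeModel hHD (cmRealisation h₃ (cmCode K Ψ)).isSmoothProjective) F hA a

/-- Off the anisotropic regime, pointwise: `deg • τ (F^* a) = (normOf … F)^* a = (eqToHom _ ≫ F)^* a` (one sheet,
`τ = id`). -/
theorem degOf_smul_transferMap_pull_apply_of_not_isAnisotropic (hA : Arapura2012_Cor_15_4_6) {L : CMField}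
    {ι₁ : L →+* ℂ} {V : HermSpace3 L ι₁} (Γ Γ₁ : Level V) (hle : Γ₁.Γ ≤ Γ.Γ) (h : ¬ IsAnisotropic L V.Hm)
    (K : CMField) (Ψ : CMType K)
    (F : (picardCMUniverse hHD hI h₁ h₃).Mor ((picardCMUniverse hHD hI h₁ h₃).pms L ι₁ V Γ₁)
      ((picardCMUniverse hHD hI h₁ h₃).cmAV K Ψ))
    (a : (picardCMUniverse hHD hI h₁ h₃).Coh ((picardCMUniverse hHD hI h₁ h₃).cmAV K Ψ) 1) :
    (degOf hHD hI h₁ h₃ hA Γ Γ₁ hle : ℚ) •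
        ((isFiniteCover_coverOf hHD hI h₁ h₃ hA Γ Γ₁ hle).transferMap (R := ℚ) 1).hom
          ((picardCMUniverse hHD hI h₁ h₃).pull F 1 a) =
      (picardCMUniverse hHD hI h₁ h₃).pull (normOf hHD hI h₁ h₃ hA Γ Γ₁ hle K Ψ F) 1 a := by
  rw [normOf, dif_neg h]
  haveI := connectedSpace_complexPoints
    (Var.isSmoothProjective (ballQuotientUniformisedDatum_of h₁) h₃ (.pms (pmsCode L ι₁ V Γ₁)))
  haveI := nonempty_complexPoints_pms (ballQuotientUniformisedDatum_of h₁) h₃ Γ₁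
  exact sheets_smul_transferMap_map_of_eq_eqToHom (scheme_pms_eq_of_not_isAnisotropic h₁ h₃ Γ Γ₁ h)
    (coverOf_eq_eqToHom_of_not_isAnisotropic hHD hI h₁ h₃ hA Γ Γ₁ hle h)
    (isFiniteCover_coverOf hHD hI h₁ h₃ hA Γ Γ₁ hle) F a

/-- **`hnorm`** — `push ∘ₗ F^* = norm^*` on `H¹(A_{(K,Ψ)}(ℂ); ℚ)`: the push-forward `pushOf = deg •` (normalised transfer)
of `Model/LevelTransferPush.lean` composed with `F^*` IS the pull-back along the norm morphism `normOf … F`. -/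
theorem pushOf_comp_pull_eq_pull_normOf (hA : Arapura2012_Cor_15_4_6) {L : CMField} {ι₁ : L →+* ℂ}
    {V : HermSpace3 L ι₁} (Γ Γ₁ : Level V) (hle : Γ₁.Γ ≤ Γ.Γ) (K : CMField) (Ψ : CMType K)
    (F : (picardCMUniverse hHD hI h₁ h₃).Mor ((picardCMUniverse hHD hI h₁ h₃).pms L ι₁ V Γ₁)
      ((picardCMUniverse hHD hI h₁ h₃).cmAV K Ψ)) :
    pushOf hHD hI h₁ h₃ hA Γ Γ₁ hle ∘ₗ (picardCMUniverse hHD hI h₁ h₃).pull F 1 =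
      (picardCMUniverse hHD hI h₁ h₃).pull (normOf hHD hI h₁ h₃ hA Γ Γ₁ hle K Ψ F) 1 := by
  apply LinearMap.ext
  intro a
  change (degOf hHD hI h₁ h₃ hA Γ Γ₁ hle : ℚ) •
      ((isFiniteCover_coverOf hHD hI h₁ h₃ hA Γ Γ₁ hle).transferMap (R := ℚ) 1).hom
        ((picardCMUniverse hHD hI h₁ h₃).pull F 1 a) =
    (picardCMUniverse hHD hI h₁ h₃).pull (normOf hHD hI h₁ h₃ hA Γ Γ₁ hle K Ψ F) 1 a
  by_cases h : IsAnisotropic L V.Hm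
  · exact degOf_smul_transferMap_pull_apply_of_isAnisotropic hHD hI h₁ h₃ hA Γ Γ₁ hle h K Ψ F a
  · exact degOf_smul_transferMap_pull_apply_of_not_isAnisotropic hHD hI h₁ h₃ hA Γ Γ₁ hle h K Ψ F a

/-- **The level transfer datum on `coverOf … Γ Γ₁ hle` with BOTH halves constructed.** -/
def levelTransferNormOf (hA : Arapura2012_Cor_15_4_6) {L : CMField} {ι₁ : L →+* ℂ} {V : HermSpace3 L ι₁}
    (Γ Γ₁ : Level V) (hle : Γ₁.Γ ≤ Γ.Γ) :
    (picardCMUniverse hHD hI h₁ h₃).LevelTransfer (coverOf hHD hI h₁ h₃ hA Γ Γ₁ hle) :=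
  levelTransferOf hHD hI h₁ h₃ hA Γ Γ₁ hle (normOf hHD hI h₁ h₃ hA Γ Γ₁ hle)
    (pushOf_comp_pull_eq_pull_normOf hHD hI h₁ h₃ hA Γ Γ₁ hle)

/-- Its norm field is `normOf` (by definition). -/
theorem levelTransferNormOf_norm (hA : Arapura2012_Cor_15_4_6) {L : CMField} {ι₁ : L →+* ℂ}
    {V : HermSpace3 L ι₁} (Γ Γ₁ : Level V) (hle : Γ₁.Γ ≤ Γ.Γ) (K : CMField) (Ψ : CMType K) (F) :
    (levelTransferNormOf hHD hI h₁ h₃ hA Γ Γ₁ hle).norm K Ψ F =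
      normOf hHD hI h₁ h₃ hA Γ Γ₁ hle K Ψ F := rfl

/-- **The family `D` of `hLiu_of_small`, fully constructed** (all hermitian spaces and nested levels at once). -/
def levelTransferFamilyNormOf (hA : Arapura2012_Cor_15_4_6) :
    ∀ {L : CMField} {ι₁ : L →+* ℂ} {V : HermSpace3 L ι₁} (Γ Γ₁ : Level V) (hle : Γ₁.Γ ≤ Γ.Γ),
      (picardCMUniverse hHD hI h₁ h₃).LevelTransfer (coverOf hHD hI h₁ h₃ hA Γ Γ₁ hle) :=
  levelTransferFamilyOf hHD hI h₁ h₃ hA (normOf hHD hI h₁ h₃ hA)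
    (pushOf_comp_pull_eq_pull_normOf hHD hI h₁ h₃ hA)

end EndState

end Model

end HodgeCM

end
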